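import Summits.ABC.IUTFork.Joshi.ATS4WildBoundLpGenuine
import Literature.IUT.LogVolume.Theorem110GenuineStepIIDatum
import Literature.IUT.HodgeTheaters.ImageContainsSL2Bridge
import Literature.NumberTheory.EllipticCurves.DivisionFieldDegreeProofs
import Literature.NumberTheory.EllipticCurves.ModularCurveGammaIndex
import HarnessLib

/-!
# Joshi, *Arithmetic Teichmüller spaces IV* [J-IV] Theorem 4.6.1 (5) read at `L′/L` (T-30's `MainBoundDatum.WildBoundLp`)
# — the degree floor DISCHARGED: `WildBoundLp` holds at the genuine theta tower for the `K` of ANY initial Θ-data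

Proof-only companion (slot T-27 lineage of plan/E/ASSIGNMENTS.md; abc-iut cell, block E, rung LADDER-ABC:A2.E; R-J census row
Y-21x⟨WildBoundLp⟩ / Y-22 of plan/E/R-J/Y-CENSUS.tsv) of `Joshi/ATS4WildBoundLpGenuine.lean` (p462358 / r1 p463787), whose §3
derives T-30's `WildBoundLp` at the genuine theta tower ABOVE A DEGREE FLOOR — `2ℓ² ≤ [L′:L]`, or `ℓ(ℓ²−1) = |SL₂(𝔽_ℓ)| ≤ [L′:L]`
taken as the hypothesis `hSL` of `thetaTower_wildBoundLp_of_card_SL_le` — and whose header records «the degree consequence is taken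
as the hypothesis, not rebuilt here». THIS FILE REBUILDS IT from [IUTchI] Def. 3.1 (c) as typed by the tree
(`Literature.IUT.HodgeTheaters.InitialThetaData`: the fields `imageContainsSL2` «the image of the outer homomorphism `G_F → GL₂(𝔽_l)`
determined by the `l`-torsion points of `E_F` contains the subgroup `SL₂(𝔽_l)`» and `range_K_iff` «`K ⊆ F̄` … the finite Galois
extension of `F` determined by the kernel of this homomorphism», kurims May-2020 manuscript p. 62), so that the floor disappears:
for Joshi's `L′` = «the number field determined by Initial Theta Data» (arXiv:2403.10430v2 p.39 l.16–18, = Mochizuki's `K = F(E_F[ℓ])`,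
Rmk. 6.1.2) one has **`[L′ : L] ≥ ℓ(ℓ²−1) = |SL₂(𝔽_ℓ)| ≥ 2ℓ²`** — the LOWER companion of Joshi's upper bound «`[L′ : L] ≤ ℓ⁴` by
Lemma 6.3.2» (p.60 l.25–26; Lem. 6.3.2 = `|GL₂(𝔽_p)| = p(p+1)(p−1)²`, p.59 l.6–7; the tree's `finrank_divisionTower_dvd`). TAKES NO SIDE
on [IUTchIII] Cor. 3.12, on Joshi's claims, or on Mochizuki's reports on them; the source is an unrefereed arXiv preprint
(arXiv:2403.10430v2, bib `Joshi2024ATS4`); typed ≠ proved ≠ endorsed. NOT an abc claim and not S-bearing (as p462358: `WildBoundLp`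
enters the §6 spine only through `MainBoundDatum.lem642a_of`, already proved on the genuine route).

## Results

§1 (Galois image, any elliptic `E/F`, `ℓ` prime) `natCard_SL_le_natCard_range_galoisRepTorsion`: under `ImageContainsSL2
  (AlgebraicClosure F) E ℓ`, **`|SL₂(𝔽_ℓ)| ≤ #ρ̄_{E,ℓ}(G_F)`** — read through the tree's bridge `imageModLContainsSL2_of_imageContainsSL2`
  (every determinant-one `𝔽_ℓ`-linear endomorphism of `E[ℓ](F̄)` is a Galois element), a choice `M ↦ σ_M` over a fixed `𝔽_ℓ`-basis is an
  INJECTION `SL₂(𝔽_ℓ) ↪ ρ̄(G_F)`; `card_SL_le_index_ker_galoisRepTorsion`: `ℓ(ℓ²−1) ≤ [G_F : Ker ρ̄]` (`|SL₂(ℤ/ℓℤ)| = ℓ(ℓ²−1)`, the tree's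
  `ModularForms.card_specialLinearGroup_zmod`, Diamond–Shurman Ex. 1.2.3).
§2 `card_SL_le_finrank_of_fixingSubgroup_le_ker`: **`ℓ(ℓ²−1) ≤ [L : F]` for every FINITE `L ⊆ F̄` with `Gal(F̄/L) ≤ Ker ρ̄_{E,ℓ}`**
  (i.e. `L ⊇ F(E[ℓ])`; Krull `[L:F] = [G_F : Gal(F̄/L)]`, Mathlib `IntermediateField.finrank_eq_fixingSubgroup_index`) — the companion
  of the tree's `finrank_dvd_of_ker_galoisRepTorsion_le_fixingSubgroup` (`L ⊆ F(E[ℓ])`: `[L:F] ∣ |GL₂(𝔽_ℓ)|`); and the same for an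
  abstract `K` presented by `ψ : K →ₐ[F] F̄` (`card_SL_le_finrank_of_fieldRange_fixingSubgroup_le_ker`).
§3 (initial Θ-data `D : InitialThetaData F K F̄ E l Pb`) `imageContainsSL2_of_algEquiv` (Def. 3.1 (c) as typed is transported along
  `F̄ ≅ AlgebraicClosure F`); `fixingSubgroup_le_ker_galoisRepTorsion_of_initialThetaData` — **`Gal(F̄/K) ≤ Ker ρ̄`**, the inclusion
  the tree did not have (`Theorem110GenuineStepIIDatum` proves `Ker ρ̄ ≤ Gal(F̄/K)`), from the `←` direction of `range_K_iff` and Krull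
  closedness of the open kernel (`fixingSubgroup_fixedField_of_isOpen`); hence `fixingSubgroup_eq_ker_…` (**`Gal(F̄/K) = Ker ρ̄`**),
  `finrank_eq_index_ker_…` (**`[K : F] = #Im(G_F → GL₂(𝔽_l))`**), `card_SL_le_finrank_of_initialThetaData` (**`ℓ(ℓ²−1) ≤ [K:F]`**)
  and `two_mul_sq_le_finrank_of_initialThetaData` (`2ℓ² ≤ [K:F]`, `ℓ ≥ 5`).
§4 `MainBoundDatum.thetaTower_wildBoundLp_of_imageContainsSL2` (explicit presentation `ψ`, both inclusions + Def. 3.1 (c)) and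
  **`MainBoundDatum.thetaTower_wildBoundLp_of_initialThetaData`: T-30's `WildBoundLp` — [J-IV] Thm. 4.6.1 (5) at `L′/L`, p.46
  l.42–46 read as in the proof of Lem. 6.4.2, p.60 l.22–30 — HOLDS at the genuine theta tower for the `K` of ANY collection of
  initial Θ-data over the Legendre curve `E_F` with theta field `F`, with NO degree-floor hypothesis** (composition with p462358's
  `thetaTower_wildBoundLp_of_card_SL_le`); `thetaTower_two_log_add_log_two_le_log_finrank_of_initialThetaData`: the additive wild
  correction `2·log ℓ + log 2` of p462358's honest display is absorbed by `log[K:F]`.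

What stays LOCATED (as in p462358): proper subfields of the division field (E-t28's `TestATS4WildBoundLpGenuine`); the theta-tower
negative member (needs `μ_ℓ ⊂ L(E[ℓ])`, Weil pairing). Theorems only; standard axioms; no `sorry`/instance/notation/new `Prop`.
-/

noncomputable section

open scoped Classical MatrixGroups

open NumberField IsDedekindDomain Literature.IUT.LogVolume Literature.IUT.LogVolume.Cor22
open Literature.NumberTheory.DiophantineGeometry.GenEll Literature.NumberTheory.DiophantineGeometry
open Literature.NumberTheory.EllipticCurves Literature.NumberTheory.GaloisRepresentations Literature.IUT.HodgeTheaters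
open WeierstrassCurve Field

namespace Summit.ABC.IUTFork.Joshi.ATS4

/-! ## 1. `|SL₂(𝔽_ℓ)| ≤ #Im(G_F → Aut E[ℓ])` under [IUTchI] Def. 3.1 (c) -/

section GaloisImage

variable {F : Type} [Field F] [NumberField F] (E : WeierstrassCurve F) [E.IsElliptic]
  (l : ℕ) [hl : Fact l.Prime]

/-- `|SL₂(ℤ/ℓℤ)| = ℓ(ℓ² − 1)` for a prime `ℓ` (the tree's `card_specialLinearGroup_zmod`,
Diamond–Shurman Ex. 1.2.3, at a prime level). [cite: DiamondShurman2005, Exercise 1.2.3(a)–(b)] -/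
theorem natCard_SL_two_zmod_prime : Nat.card SL(2, ZMod l) = l * (l ^ 2 - 1) := by
  -- adapted from Summits/ABC/ABC/Theorems/IsogenyGlueCongruenceEllipticGluingPrimeBoundStubGoursatIndexDichotomy.lean
  rw [ModularForms.card_specialLinearGroup_zmod, hl.out.factorization, Finsupp.prod,
    Finsupp.support_single _ one_ne_zero, Finset.prod_singleton, Finsupp.single_eq_same]
  have hsq : l ^ 2 - 1 = (l + 1) * (l - 1) := by
    obtain ⟨k, rfl⟩ : ∃ k, l = k + 1 := ⟨l - 1, by have := hl.out.pos; omega⟩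
    rw [Nat.add_sub_cancel]
    exact Nat.sub_eq_of_eq_add (by ring)
  simp [hsq]

/-- The image `ρ̄_{E,ℓ}(G_F) ⊆ Aut(E[ℓ])` is finite (its order divides `|GL₂(𝔽_ℓ)|`, tree
`natCard_range_galoisRepTorsion_dvd`). [cite: Serre1972, §4.1] -/
theorem finite_range_galoisRepTorsion : Finite (E.galoisRepTorsion (l : ℤ)).range := by
  refine Nat.finite_of_card_ne_zero fun h0 => ?_
  have h := E.natCard_range_galoisRepTorsion_dvd l
  rw [h0] at h
  have h' := Nat.eq_zero_of_zero_dvd h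
  have h1 : 1 ≤ l - 1 := by have := hl.out.two_le; omega
  have : 0 < l * (l - 1) ^ 2 * (l + 1) := by
    have := hl.out.pos
    positivity
  omega

/-- **`|SL₂(𝔽_ℓ)| ≤ #ρ̄_{E,ℓ}(G_F)` under [IUTchI] Def. 3.1 (c)** «the image of the outer homomorphism
`G_F → GL₂(𝔽_l)` determined by the `l`-torsion points of `E_F` contains the subgroup `SL₂(𝔽_l)`» as TYPED
(`ImageContainsSL2`, read through the tree's bridge `imageModLContainsSL2_of_imageContainsSL2`: every
determinant-one `𝔽_ℓ`-linear endomorphism of `E[ℓ](F̄)` is a Galois element): choosing for each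
`M ∈ SL₂(𝔽_ℓ)` a `σ_M ∈ G_F` acting as `M` in a fixed `𝔽_ℓ`-basis gives an INJECTION
`SL₂(𝔽_ℓ) ↪ ρ̄(G_F)`. [claim: Mochizuki2012, status: disputed] -/
theorem natCard_SL_le_natCard_range_galoisRepTorsion (h : ImageContainsSL2 (AlgebraicClosure F) E l) :
    Nat.card SL(2, ZMod l) ≤ Nat.card (E.galoisRepTorsion (l : ℤ)).range := by
  letI inst : Module (ZMod l) (E.geomTorsion (l : ℤ)) := AddSubgroup.torsionBy.zmodModule
  have h' : ∀ f : E.geomTorsion (l : ℤ) →ₗ[ZMod l] E.geomTorsion (l : ℤ), LinearMap.det f = 1 →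
      ∃ σ : Field.absoluteGaloisGroup F, ∀ x : E.geomTorsion (l : ℤ), σ • x = f x :=
    imageModLContainsSL2_of_imageContainsSL2 E l h
  have hrank : Module.finrank (ZMod l) (E.geomTorsion (l : ℤ)) = 2 := finrank_geomTorsion_eq_two E l
  haveI : Finite (E.geomTorsion (l : ℤ)) := Nat.finite_of_card_ne_zero
    (by rw [natCard_geomTorsion_eq_sq E l]; exact pow_ne_zero _ hl.out.ne_zero)
  haveI : Module.Finite (ZMod l) (E.geomTorsion (l : ℤ)) := Module.Finite.of_finite
  let b : Module.Basis (Fin 2) (ZMod l) (E.geomTorsion (l : ℤ)) :=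
    Module.finBasisOfFinrankEq (ZMod l) _ hrank
  have key : ∀ M : SL(2, ZMod l), ∃ σ : Field.absoluteGaloisGroup F,
      ∀ x : E.geomTorsion (l : ℤ), σ • x = Matrix.toLin b b (M : Matrix (Fin 2) (Fin 2) (ZMod l)) x :=
    fun M => h' _ (by rw [LinearMap.det_toLin]; exact M.det_coe)
  choose σ hσ using key
  haveI := finite_range_galoisRepTorsion E l
  refine Nat.card_le_card_of_injective
    (fun M => (⟨E.galoisRepTorsion (l : ℤ) (σ M), ⟨σ M, rfl⟩⟩ : (E.galoisRepTorsion (l : ℤ)).range)) ?_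
  intro M N hMN
  have h1 : E.galoisRepTorsion (l : ℤ) (σ M) = E.galoisRepTorsion (l : ℤ) (σ N) :=
    congrArg Subtype.val hMN
  have h2 : Matrix.toLin b b (M : Matrix (Fin 2) (Fin 2) (ZMod l)) =
      Matrix.toLin b b (N : Matrix (Fin 2) (Fin 2) (ZMod l)) := by
    apply LinearMap.ext
    intro x
    rw [← hσ M x, ← hσ N x, ← galoisRepTorsion_apply, ← galoisRepTorsion_apply, h1]
  have h3 := (Matrix.toLin b b).injective h2
  exact Subtype.ext h3

/-- **`ℓ(ℓ²−1) = |SL₂(𝔽_ℓ)| ≤ #ρ̄_{E,ℓ}(G_F) = [G_F : Ker ρ̄_{E,ℓ}]`** under Def. 3.1 (c) as typed.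
[claim: Mochizuki2012, status: disputed] -/
theorem card_SL_le_index_ker_galoisRepTorsion (h : ImageContainsSL2 (AlgebraicClosure F) E l) :
    l * (l ^ 2 - 1) ≤ (E.galoisRepTorsion (l : ℤ)).ker.index := by
  rw [Subgroup.index_ker, ← natCard_SL_two_zmod_prime l]
  exact natCard_SL_le_natCard_range_galoisRepTorsion E l h

/-! ## 2. `ℓ(ℓ²−1) ≤ [L : F]` for every finite `F(E[ℓ]) ⊆ L ⊆ F̄` -/

/-- **`ℓ(ℓ²−1) ≤ [L : F]` for every FINITE subextension `L ⊆ F̄ = AlgebraicClosure F` CONTAINING the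
`ℓ`-division field**, i.e. with `Gal(F̄/L) ≤ Ker ρ̄_{E,ℓ}`, under Def. 3.1 (c) as typed: `[L:F] =
[G_F : Gal(F̄/L)]` (Krull) is a positive multiple of `[G_F : Ker ρ̄] = #ρ̄(G_F) ≥ |SL₂(𝔽_ℓ)|`. (The tree's
`finrank_dvd_of_ker_galoisRepTorsion_le_fixingSubgroup` is the OTHER inequality, for `L` INSIDE the
division field.) [claim: Mochizuki2012, status: disputed] -/
theorem card_SL_le_finrank_of_fixingSubgroup_le_ker (h : ImageContainsSL2 (AlgebraicClosure F) E l)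
    (L : IntermediateField F (AlgebraicClosure F)) [FiniteDimensional F L]
    (hL : L.fixingSubgroup ≤ (E.galoisRepTorsion (l : ℤ)).ker) :
    l * (l ^ 2 - 1) ≤ Module.finrank F L := by
  rw [IntermediateField.finrank_eq_fixingSubgroup_index]
  have hpos : 0 < L.fixingSubgroup.index := by
    rw [← IntermediateField.finrank_eq_fixingSubgroup_index]; exact Module.finrank_pos
  exact (card_SL_le_index_ker_galoisRepTorsion E l h).trans
    (Nat.le_of_dvd hpos (Subgroup.index_dvd_of_le hL))

/-- The same for an ABSTRACT finite extension `K/F` PRESENTED by an `F`-embedding `ψ : K → F̄` whose image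
contains the `ℓ`-division field (`Gal(F̄/ψK) ≤ Ker ρ̄_{E,ℓ}`): `ℓ(ℓ²−1) ≤ [K : F]`.
[claim: Mochizuki2012, status: disputed] -/
theorem card_SL_le_finrank_of_fieldRange_fixingSubgroup_le_ker (h : ImageContainsSL2 (AlgebraicClosure F) E l)
    {K : Type} [Field K] [Algebra F K] [FiniteDimensional F K] (ψ : K →ₐ[F] AlgebraicClosure F)
    (hK : ψ.fieldRange.fixingSubgroup ≤ (E.galoisRepTorsion (l : ℤ)).ker) :
    l * (l ^ 2 - 1) ≤ Module.finrank F K := by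
  let e : K ≃ₐ[F] ψ.fieldRange :=
    ((IntermediateField.topEquiv (F := F) (E := K)).symm.trans (IntermediateField.equivMap ⊤ ψ)).trans
      (IntermediateField.equivOfEq (AlgHom.fieldRange_eq_map ψ).symm)
  haveI : FiniteDimensional F ψ.fieldRange := LinearEquiv.finiteDimensional e.toLinearEquiv
  rw [e.toLinearEquiv.finrank_eq]
  exact card_SL_le_finrank_of_fixingSubgroup_le_ker E l h ψ.fieldRange hK

end GaloisImage
/-! ## 3. Initial Θ-data: Def. 3.1 (c) along `F̄ ≅ AlgebraicClosure F`, and `Gal(F̄/K) = Ker ρ̄_{E_F,ℓ}` -/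

section Transport

variable {F : Type} [Field F] (E : WeierstrassCurve F) (l : ℕ)
  {Ω Ω' : Type} [Field Ω] [Algebra F Ω] [Field Ω'] [Algebra F Ω']

/-- **Def. 3.1 (c) as typed is stable under `F`-isomorphisms of the algebraically closed field**: an
`𝔽_l`-basis `(P, Q)` of `E[l](Ω)` realising every determinant-one integer matrix by a Galois element is
carried by `ι : Ω ≃ₐ[F] Ω'` to such a basis of `E[l](Ω')` (conjugating the Galois elements by `ι`;
transport of points, Silverman VIII.§1). [claim: Mochizuki2012, status: disputed] -/
theorem imageContainsSL2_of_algEquiv (ι : Ω ≃ₐ[F] Ω') (h : ImageContainsSL2 Ω E l) :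
    ImageContainsSL2 Ω' E l := by
  obtain ⟨P, Q, hP, hQ, hind, hspan, hreal⟩ := h
  -- transport of points along `ι` and `ι⁻¹`
  let m : GeomPoints Ω E →+ GeomPoints Ω' E := Affine.Point.map (W' := E.toAffine) (ι : Ω →ₐ[F] Ω')
  let m' : GeomPoints Ω' E →+ GeomPoints Ω E :=
    Affine.Point.map (W' := E.toAffine) ((ι.symm : Ω' ≃ₐ[F] Ω) : Ω' →ₐ[F] Ω)
  have hm'm : ∀ T, m' (m T) = T := by
    intro T; show Affine.Point.map _ (Affine.Point.map _ T) = T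
    rw [Affine.Point.map_map]
    have hid : ((ι.symm : Ω' ≃ₐ[F] Ω) : Ω' →ₐ[F] Ω).comp (ι : Ω →ₐ[F] Ω') = AlgHom.id F Ω := by
      ext x; exact ι.symm_apply_apply x
    rw [hid]; cases T <;> rfl
  have hmm' : ∀ T, m (m' T) = T := by
    intro T; show Affine.Point.map _ (Affine.Point.map _ T) = T
    rw [Affine.Point.map_map]
    have hid : (ι : Ω →ₐ[F] Ω').comp ((ι.symm : Ω' ≃ₐ[F] Ω) : Ω' →ₐ[F] Ω) = AlgHom.id F Ω' := by
      ext x; exact ι.apply_symm_apply x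
    rw [hid]; cases T <;> rfl
  -- the conjugate `ι ∘ σ ∘ ι⁻¹` acts on transported points as `σ` does
  have hconj : ∀ (σ : Ω ≃ₐ[F] Ω) (T : GeomPoints Ω E),
      galoisAct E ((ι.symm.trans σ).trans ι) (m T) = m (galoisAct E σ T) := by
    intro σ T
    unfold galoisAct
    show Affine.Point.map _ (Affine.Point.map _ T) = Affine.Point.map _ (Affine.Point.map _ T)
    rw [Affine.Point.map_map, Affine.Point.map_map]
    have hcomp : (((ι.symm.trans σ).trans ι : Ω' ≃ₐ[F] Ω') : Ω' →ₐ[F] Ω').comp (ι : Ω →ₐ[F] Ω') =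
        (ι : Ω →ₐ[F] Ω').comp ((σ : Ω ≃ₐ[F] Ω) : Ω →ₐ[F] Ω) := by
      ext x
      show ι (σ (ι.symm (ι x))) = ι (σ x)
      rw [ι.symm_apply_apply]
    rw [hcomp]
  refine ⟨m P, m Q, ?_, ?_, ?_, ?_, ?_⟩
  · rw [← map_zsmul, hP, map_zero]
  · rw [← map_zsmul, hQ, map_zero]
  · intro a b hab
    apply hind
    have := congrArg m' hab
    rwa [map_add, map_zsmul, map_zsmul, hm'm, hm'm, map_zero] at this
  · intro T hT
    obtain ⟨a, b, hab⟩ := hspan (m' T) (by rw [← map_zsmul, hT, map_zero])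
    refine ⟨a, b, ?_⟩
    rw [← hmm' T, hab, map_add, map_zsmul, map_zsmul]
  · intro a b c d hdet
    obtain ⟨σ, hσP, hσQ⟩ := hreal a b c d hdet
    refine ⟨(ι.symm.trans σ).trans ι, ?_, ?_⟩
    · rw [hconj, hσP, map_add, map_zsmul, map_zsmul]
    · rw [hconj, hσQ, map_add, map_zsmul, map_zsmul]

end Transport
section Datum

variable {F : Type} [Field F] [NumberField F] {K : Type} [Field K] [NumberField K] [Algebra F K]
  {Fbar : Type} [Field Fbar] [Algebra F Fbar] [Algebra K Fbar]
  {E : WeierstrassCurve F} [E.IsElliptic] {l : ℕ} {Pb : BadPlacePredicates K}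

/-- **`Gal(F̄/K) ≤ Ker ρ̄_{E_F,l}` for initial Θ-data** — the inclusion the tree did not yet have (its
`ker_galoisRepTorsion_le_fixingSubgroup_of_initialThetaData` is the other one): by Def. 3.1 (c) `range_K_iff`
(«`K ⊆ F̄` … the finite Galois extension of `F` determined by the kernel of this homomorphism») every element
of `AlgebraicClosure F` fixed by `Ker ρ̄` lies in `ι(K)` for any `F`-isomorphism `ι : F̄ ≅ AlgebraicClosure F`
(transport of torsion-fixing automorphisms, `fixesTorsion_conj`), and `Ker ρ̄` is open hence Krull-closed
(`fixingSubgroup_fixedField_of_isOpen`). [claim: Mochizuki2012, status: disputed] -/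
theorem fixingSubgroup_le_ker_galoisRepTorsion_of_initialThetaData (D : InitialThetaData F K Fbar E l Pb)
    (ι : Fbar ≃ₐ[F] AlgebraicClosure F) :
    (((ι : Fbar →ₐ[F] AlgebraicClosure F).comp
        (@IsScalarTower.toAlgHom F K Fbar _ _ _ _ _ _ D.isScalarTower)).fieldRange).fixingSubgroup ≤
      (E.galoisRepTorsion (l : ℤ)).ker := by
  haveI := D.isScalarTower
  haveI : Fact l.Prime := ⟨D.l_prime⟩
  have hle : IntermediateField.fixedField (E.galoisRepTorsion (l : ℤ)).ker ≤
      ((ι : Fbar →ₐ[F] AlgebraicClosure F).comp (IsScalarTower.toAlgHom F K Fbar)).fieldRange := by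
    intro x hx
    rw [IntermediateField.mem_fixedField_iff] at hx
    have hy : ∀ σ : Fbar ≃ₐ[F] Fbar, FixesTorsion (Fbar := Fbar) E l σ → σ (ι.symm x) = ι.symm x := by
      intro σ hσ
      have hfix := fixesTorsion_conj E l ι.symm hσ
      rw [AlgEquiv.symm_symm] at hfix
      let σe : AlgebraicClosure F ≃ₐ[F] AlgebraicClosure F := (ι.symm.trans σ).trans ι
      have hmem : (σe : Field.absoluteGaloisGroup F) ∈ (E.galoisRepTorsion (l : ℤ)).ker :=
        (fixesTorsion_iff_mem_ker E l σe).1 hfix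
      have hx' : ι (σ (ι.symm x)) = x := hx σe hmem
      calc σ (ι.symm x) = ι.symm (ι (σ (ι.symm x))) := (ι.symm_apply_apply _).symm
        _ = ι.symm x := by rw [hx']
    obtain ⟨k, hk⟩ := (D.range_K_iff (ι.symm x)).2 hy
    rw [AlgHom.mem_fieldRange]
    refine ⟨k, ?_⟩
    show ι (IsScalarTower.toAlgHom F K Fbar k) = x
    rw [IsScalarTower.coe_toAlgHom', hk, AlgEquiv.apply_symm_apply]
  exact (IntermediateField.fixingSubgroup_antitone hle).trans
    (le_of_eq (fixingSubgroup_fixedField_of_isOpen _ (isOpen_ker_galoisRepTorsion_prime E l)))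

/-- **`Gal(F̄/K) = Ker(G_F → GL₂(𝔽_l))` for initial Θ-data** (Def. 3.1 (c) «the finite Galois extension of
`F` determined by the kernel of this homomorphism», read in `AlgebraicClosure F` along any
`ι : F̄ ≅ AlgebraicClosure F`): both inclusions. [claim: Mochizuki2012, status: disputed] -/
theorem fixingSubgroup_eq_ker_galoisRepTorsion_of_initialThetaData (D : InitialThetaData F K Fbar E l Pb)
    (ι : Fbar ≃ₐ[F] AlgebraicClosure F) :
    (((ι : Fbar →ₐ[F] AlgebraicClosure F).comp
        (@IsScalarTower.toAlgHom F K Fbar _ _ _ _ _ _ D.isScalarTower)).fieldRange).fixingSubgroup =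
      (E.galoisRepTorsion (l : ℤ)).ker :=
  le_antisymm (fixingSubgroup_le_ker_galoisRepTorsion_of_initialThetaData D ι)
    (ker_galoisRepTorsion_le_fixingSubgroup_of_initialThetaData D ι)

/-- Def. 3.1 (c) «the image … contains `SL₂(𝔽_l)`» for initial Θ-data, read in `AlgebraicClosure F` (the
algebraic closure over which the tree's `galoisRepTorsion` lives). [claim: Mochizuki2012, status: disputed] -/
theorem imageContainsSL2_algebraicClosure_of_initialThetaData (D : InitialThetaData F K Fbar E l Pb)
    (ι : Fbar ≃ₐ[F] AlgebraicClosure F) : ImageContainsSL2 (AlgebraicClosure F) E l :=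
  imageContainsSL2_of_algEquiv E l ι D.imageContainsSL2

/-- **`[K : F] = #Im(G_F → GL₂(𝔽_l)) = [G_F : Ker ρ̄_{E_F,l}]` for initial Θ-data** (Krull: `[K:F] =
[G_F : Gal(F̄/K)]`, and `Gal(F̄/K) = Ker ρ̄`). [claim: Mochizuki2012, status: disputed] -/
theorem finrank_eq_index_ker_galoisRepTorsion_of_initialThetaData (D : InitialThetaData F K Fbar E l Pb) :
    Module.finrank F K = (E.galoisRepTorsion (l : ℤ)).ker.index := by
  haveI := D.isScalarTower
  haveI := D.isAlgClosure
  let ι : Fbar ≃ₐ[F] AlgebraicClosure F := IsAlgClosure.equiv F Fbar (AlgebraicClosure F)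
  let ψ : K →ₐ[F] AlgebraicClosure F :=
    (ι : Fbar →ₐ[F] AlgebraicClosure F).comp (IsScalarTower.toAlgHom F K Fbar)
  let e : K ≃ₐ[F] ψ.fieldRange :=
    ((IntermediateField.topEquiv (F := F) (E := K)).symm.trans (IntermediateField.equivMap ⊤ ψ)).trans
      (IntermediateField.equivOfEq (AlgHom.fieldRange_eq_map ψ).symm)
  rw [e.toLinearEquiv.finrank_eq, IntermediateField.finrank_eq_fixingSubgroup_index,
    fixingSubgroup_eq_ker_galoisRepTorsion_of_initialThetaData D ι]
  rfl

/-- **`ℓ(ℓ²−1) = |SL₂(𝔽_l)| ≤ [K : F]` for the `K` of ANY initial Θ-data** ([IUTchI] Def. 3.1 (c) as typed: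
`imageContainsSL2` + `range_K_iff`; no further hypothesis). [claim: Mochizuki2012, status: disputed] -/
theorem card_SL_le_finrank_of_initialThetaData (D : InitialThetaData F K Fbar E l Pb) :
    l * (l ^ 2 - 1) ≤ Module.finrank F K := by
  haveI := D.isScalarTower
  haveI := D.isAlgClosure
  haveI : Fact l.Prime := ⟨D.l_prime⟩
  haveI : FiniteDimensional F K := Module.Finite.of_restrictScalars_finite ℚ F K
  let ι : Fbar ≃ₐ[F] AlgebraicClosure F := IsAlgClosure.equiv F Fbar (AlgebraicClosure F)
  exact card_SL_le_finrank_of_fieldRange_fixingSubgroup_le_ker E l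
    (imageContainsSL2_algebraicClosure_of_initialThetaData D ι) _
    (fixingSubgroup_le_ker_galoisRepTorsion_of_initialThetaData D ι)

/-- Numeric form: **`2ℓ² ≤ ℓ(ℓ²−1) ≤ [K : F]`** for initial Θ-data (`ℓ ≥ 5`), the floor of p462358's
`thetaTower_wildBoundLp_of_le_finrank`. [claim: Mochizuki2012, status: disputed] -/
theorem two_mul_sq_le_finrank_of_initialThetaData (D : InitialThetaData F K Fbar E l Pb) :
    2 * l ^ 2 ≤ Module.finrank F K :=
  (MainBoundDatum.two_mul_sq_le_card_SL D.five_le_l).trans (card_SL_le_finrank_of_initialThetaData D)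

end Datum
/-! ## 4. `WildBoundLp` at the genuine theta tower for the `K` of initial Θ-data — no degree floor -/

namespace MainBoundDatum

section Theta
variable (Lmod : Type*) [Field Lmod] [NumberField Lmod]
variable {P : NFPoint} {F : Type} [Field F] [NumberField F] [Algebra P.F F]
  {K : Type} [Field K] [NumberField K] [Algebra F K] [Algebra P.F K] [IsScalarTower P.F F K]
  {Fbar : Type} [Field Fbar] [Algebra F Fbar] [Algebra K Fbar]
  {ℓ : ℕ} {Pb : BadPlacePredicates K}

/-- **`WildBoundLp` DERIVED at the genuine theta tower for `K ⊇ F(E_F[ℓ])` under Def. 3.1 (c)** (explicit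
presentation `ψ : K → AlgebraicClosure F`): if `Gal(F̄/ψK) = Ker ρ̄_{E_F,ℓ}` (both inclusions: `K` IS the
`ℓ`-division field, Joshi's `L′ = L(E[ℓ])`, p.39 l.16–18) and the image of `G_F → GL₂(𝔽_ℓ)` contains `SL₂(𝔽_ℓ)`,
then `[L′:L] ≥ ℓ(ℓ²−1)` and p462358's `thetaTower_wildBoundLp_of_card_SL_le` applies: [J-IV] Thm. 4.6.1 (5) read
at `L′/L` (T-30's `WildBoundLp`) HOLDS, with no degree-floor hypothesis left. [claim: Joshi2024ATS4, status: disputed] -/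
theorem thetaTower_wildBoundLp_of_imageContainsSL2 (ψ : K →ₐ[F] AlgebraicClosure F) (hℓ : ℓ.Prime)
    (h5 : 5 ≤ ℓ) (hq : 0 < (TateDivisorDatum.ofNFPointOver P {2, ℓ} F).logq) (hU : P.InU)
    (hF : IsThetaField P F) [IsGalois F K]
    (hK : letI := thetaCurve_isElliptic hU F
      ((thetaCurve P F).galoisRepTorsion (ℓ : ℤ)).ker ≤ ψ.fieldRange.fixingSubgroup)
    (hK' : letI := thetaCurve_isElliptic hU F
      ψ.fieldRange.fixingSubgroup ≤ ((thetaCurve P F).galoisRepTorsion (ℓ : ℤ)).ker)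
    (hSL : ImageContainsSL2 (AlgebraicClosure F) (thetaCurve P F) ℓ) :
    (ofGenuine Lmod hℓ h5 (TateDivisorDatum.ofNFPoint P {2, ℓ}) (TateDivisorDatum.ofNFPointOver P {2, ℓ} F)
      (TateDivisorDatum.ofNFPointOver P {2, ℓ} K) hq).WildBoundLp := by
  letI := thetaCurve_isElliptic hU F
  haveI : Fact ℓ.Prime := ⟨hℓ⟩
  haveI : FiniteDimensional F K := Module.Finite.of_restrictScalars_finite ℚ F K
  exact thetaTower_wildBoundLp_of_card_SL_le Lmod ψ hℓ h5 hq hU hF hK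
    (card_SL_le_finrank_of_fieldRange_fixingSubgroup_le_ker (thetaCurve P F) ℓ hSL ψ hK')

/-- **`WildBoundLp` DERIVED at the genuine theta tower for the `K` of ANY collection of initial Θ-data
over the Legendre curve `E_F` with theta field `F`** (`InitialThetaData F K F̄ E_F ℓ Pb`, [IUTchI] Def. 3.1 as
typed by the tree): (log d^{L′} + log f^{L′}) − (log d^L + log f^L) ≤ log [L′ : L] — [J-IV] Thm. 4.6.1 (5) at
`L′/L` — with NO degree-floor hypothesis: the floor `ℓ(ℓ²−1) ≤ [K:F]` of p462358 is DISCHARGED from Def. 3.1 (c)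
(`imageContainsSL2`, `range_K_iff`) via §3. Not S-bearing; typed ≠ proved ≠ endorsed.
[claim: Joshi2024ATS4, status: disputed] -/
theorem thetaTower_wildBoundLp_of_initialThetaData (hU : P.InU) (hF : IsThetaField P F)
    [hE : (thetaCurve P F).IsElliptic] (D : InitialThetaData F K Fbar (thetaCurve P F) ℓ Pb)
    (hq : 0 < (TateDivisorDatum.ofNFPointOver P {2, ℓ} F).logq) :
    (ofGenuine Lmod D.l_prime D.five_le_l (TateDivisorDatum.ofNFPoint P {2, ℓ})
      (TateDivisorDatum.ofNFPointOver P {2, ℓ} F) (TateDivisorDatum.ofNFPointOver P {2, ℓ} K) hq).WildBoundLp := by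
  haveI := D.isScalarTower
  haveI := D.isAlgClosure
  haveI : IsGalois F K := isGalois_F_K_of_initialThetaData D
  let ι : Fbar ≃ₐ[F] AlgebraicClosure F := IsAlgClosure.equiv F Fbar (AlgebraicClosure F)
  let ψ : K →ₐ[F] AlgebraicClosure F :=
    (ι : Fbar →ₐ[F] AlgebraicClosure F).comp (IsScalarTower.toAlgHom F K Fbar)
  exact thetaTower_wildBoundLp_of_imageContainsSL2 Lmod ψ D.l_prime D.five_le_l hq hU hF
    (ker_galoisRepTorsion_le_fixingSubgroup_of_initialThetaData D ι)
    (fixingSubgroup_le_ker_galoisRepTorsion_of_initialThetaData D ι)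
    (imageContainsSL2_algebraicClosure_of_initialThetaData D ι)

omit [Algebra P.F K] [IsScalarTower P.F F K] in
/-- **The honest `L′/L` display for initial Θ-data, floor discharged**: `(log d^{L′} + log f^{L′}) −
(log d^L + log f^L) ≤ 2·log ℓ + log 2 ≤ log(2ℓ²) ≤ log [K : F]`, i.e. the additive wild correction of
p462358's `thetaTower_wildBoundLp_honest` is ABSORBED by `log[K:F]` for every initial Θ-data.
[claim: Joshi2024ATS4, status: disputed] -/
theorem thetaTower_two_log_add_log_two_le_log_finrank_of_initialThetaData
    [hE : (thetaCurve P F).IsElliptic] (D : InitialThetaData F K Fbar (thetaCurve P F) ℓ Pb) :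
    2 * Real.log ℓ + Real.log 2 ≤ Real.log (Module.finrank F K : ℕ) :=
  two_log_add_log_two_le D.five_le_l (two_mul_sq_le_finrank_of_initialThetaData D)

end Theta
end MainBoundDatum

end Summit.ABC.IUTFork.Joshi.ATS4

end
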